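import Summits.CriticalPhenomena.CardyFormulaZ2.Theorems.CardyComplexConeEdgePrecompactUFRSArmDomination

/-!
# Arm domination, INITIAL case: the certificate at the last departure when the translate's run reaches the ball
(line `qkz-strip-boundary-arm` of crux `CardyComplexCone.EdgePrecompact`, stmt-CriticalPhenomena-11387;
analysis of the registered residual `ufrs_initialContactCase_cert(J)` of the corrected arm domination
`ufrs_armDomination2`, see `…UFRSArmDominationInitial.lean`, `…UFRSArmDominationResiduals.lean`,
`…UFRSInitialContactFarBigon.lean`, `…UFRSInitialExitLoop.lean`)

Setting: an admissible datum `E` of the Jordan Dobrushin domain `D`, its translate `shiftData E w`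
(`‖E.δ w‖ < η`), the START pair `a`, `a'`, the good first stretch `S₀ = O₀ a [0, n]` of
`β₀ = E.bcBondConfig ω` entering the `2ρ`-deep ball `B(E.δ v, ρ)` at time `n`, and the run
`R₁ = O₁ a' [0, T]` of `β₁ = (shiftData E w).bcBondConfig ω` through inner faces of the translate,
avoiding the ball before `T` and ENTERING it at time `T` (target of `O₁ a' T` in the ball).

`ufrs_initialBall_lastSplit_IC`: if `R₁` meets `S₀` (some `O₁ a' k = O₀ a m`, `k ≤ T`, `m ≤ n`) but
does not end ON the end of `S₀` (`O₁ a' T ≠ O₀ a n`), the certificate `ω ∈ ufrsCert E w z (4η) (ρ/2)`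
holds at a collar point `z ∈ D`: at the LAST contact `ζ = O₁ a' k⋆ = O₀ a m⋆` (last in the time of
`R₁`) one has `k⋆ < T`, `m⋆ < n`, the two successors differ, so `cTgt ζ` is a discrepancy edge and
`ζ` a collar corner (`collarAgreement`), and the three pieces `O₀ a (m⋆, n]` (to the ball),
`O₁ a' (k⋆, T]` (to the ball) and `O₀ a [0, m⋆)` (back to the marked edge `e_a = cSrc a`) are
pairwise corner-disjoint (`S₀`, `R₁` simple; lastness): two long strands and a marked prefix
(`mem_ufrsCert_of_two_far_and_marked_W3H`, `mem_ufrsCert_of_three_far_W3H`). No hypothesis on the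
turning offsets is used (item 1 of the correction of the road map, `…UFRSAnnulusCrossings.lean`,
for the INITIAL data).

Role: together with `ufrs_initialExit_loopCert_IC` (EXIT configuration) this leaves, of the
residual `ufrs_initialContactCase_certJ`, only the configuration in which the translate's run ends
ON the re-entry corner (`O₁ a' T = O₀ a n`, a final merge with nonzero offset followed by a common
tail into the ball) — the true planar residual.

References: S. Smirnov, C. R. Acad. Sci. Paris 333 (2001), §2; G. Grimmett, *Percolation* (1999),
§11.2; P. Nolin, Electron. J. Probab. 13 (2008), §4.
-/

set_option linter.unusedVariables false

namespace Summit.CriticalPhenomena.CardyFormulaZ2.Cruxes.EdgePrecompact.QkzStripBoundaryArm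

open MeasureTheory Filter Set Metric
open scoped Topology BigOperators Pointwise
open Literature.Probability.LatticeModels Literature.Probability.Percolation
open Literature.Probability.RandomPlanarGeometry (DobrushinDomain)
open Summit.CriticalPhenomena.CardyFormulaZ2.Theses.CardyComplexCone

noncomputable section

/-- **INITIAL case, the translate's run reaches the ball off the re-entry corner: the last
departure certifies** (helper `ufrs_initialBall_lastSplit_IC` of stmt-CriticalPhenomena-11387).
DATA: start corners `a` of `E` and `a'` of `shiftData E w`, the good first stretch `O₀ a [0, n]`
entering the `2ρ`-deep ball of radius `ρ ≥ 4η` at `n`, the run `O₁ a' [0, T]` of the translate's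
completion through its inner faces avoiding the ball before `T` and entering it at `T`, a contact
`O₁ a' k = O₀ a m` (`k ≤ T`, `m ≤ n`), and `O₁ a' T ≠ O₀ a n`. CONCLUSION:
`ω ∈ ufrsCert E w z (4η) (ρ/2)` at a collar point `z ∈ D`. PROOF: outside the escape regime, take
the last contact `O₁ a' k⋆ = O₀ a m⋆` (`Nat.findGreatest`); `k⋆ = T` would force `m⋆ = n`, and
`m⋆ = n` would put the target of `O₁ a' k⋆`, `k⋆ < T`, in the ball; the successors differ by
lastness, so `cTgt (O₀ a m⋆)` is a discrepancy edge and `z = E.δ (O₀ a m⋆).1` a collar point, at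
which `O₀ a [m⋆ + 1, n]` and `O₁ a' [k⋆ + 1, T]` are two corner-disjoint long strands (their ends
are next to the ball, `far_of_near_cTgt_mem_ball_W3H`) and `O₀ a [0, m⋆ - 1]` leads back to the
marked edge `cSrc a`: FAR if that prefix is long, NEAR/MARKED otherwise. -/
theorem ufrs_initialBall_lastSplit_IC : ∀ (D : DobrushinDomain) (η : ℝ), 0 < η → ∃ δ₀ > (0:ℝ), ∀ E : DiscreteDobrushin, E.Ω = D.carrier → E.IsZdAdmissible → E.δ < δ₀ → ∀ (v w : Site 2) (ρ : ℝ), 4 * η ≤ ρ → 2 * ρ ≤ infDist (meshPoint E.δ v) D.carrierᶜ → ‖meshPoint E.δ w‖ < η → ∀ (ω : BondConfig (Site 2)) (a a' : Site 2 × Fin 4) (n T : ℕ), E.IsStartCorner a → (shiftData E w).IsStartCorner a' → (∀ i < n, medialPoint E.δ (cTgt (cornerOrbit (E.bcBondConfig ω) a i)) ∉ ball (meshPoint E.δ v) ρ ∧ E.IsInnerFace (cFace (cornerOrbit (E.bcBondConfig ω) a (i + 1)))) → medialPoint E.δ (cTgt (cornerOrbit (E.bcBondConfig ω) a n)) ∈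 ball (meshPoint E.δ v) ρ → (∀ i < T, medialPoint E.δ (cTgt (cornerOrbit ((shiftData E w).bcBondConfig ω) a' i)) ∉ ball (meshPoint E.δ v) ρ ∧ (shiftData E w).IsInnerFace (cFace (cornerOrbit ((shiftData E w).bcBondConfig ω) a' (i + 1)))) → medialPoint E.δ (cTgt (cornerOrbit ((shiftData E w).bcBondConfig ω) a' T)) ∈ ball (meshPoint E.δ v) ρ → (∃ k ≤ T, ∃ m ≤ n, cornerOrbit ((shiftData E w).bcBondConfig ω) a' k = cornerOrbit (E.bcBondConfig ω) a m) → cornerOrbit ((shiftData E w).bcBondConfig ω) a' T ≠ cornerOrbit (E.bcBondConfig ω) a n → ∃ z ∈ D.carrier, infDist z D.carrierᶜ < 3 * η ∧ ω ∈ ufrsCert E w z (4 * η) (ρ / 2) := by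
  classical
  intro D η hη
  obtain ⟨δ₂, hδ₂, hcollar⟩ := collarAgreement D η hη
  refine ⟨min δ₂ η, lt_min hδ₂ hη, ?_⟩
  intro E hEΩ hE hEδ v w ρ hηρ hv hw ω a a' n T ha ha' hStr hball hrun hTball hcontact hlast
  have hδ : 0 < E.δ := hE.delta_pos
  have hδ₂' : E.δ < δ₂ := lt_of_lt_of_le hEδ (min_le_left _ _)
  have hδη : E.δ ≤ η := (lt_of_lt_of_le hEδ (min_le_right _ _)).le
  -- the two dynamics agree off the collar; faces at deep vertices are inner for both
  have hagree : ∀ p : Site 2 × Fin 4, 3 * η ≤ infDist (meshPoint E.δ p.1) D.carrierᶜ → (cTgt p ∈ (E.bcBondConfig ω) ↔ cTgt p ∈ ((shiftData E w).bcBondConfig ω)) := by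
    rintro ⟨y, kk⟩ hp
    have h := (hcollar E hEΩ hE hδ₂' w hw ω y hp y (by rw [dist_self]; positivity)).1 kk
    exact h.1.trans h.2.symm
  have hcol_of_disc : ∀ p : Site 2 × Fin 4, ¬ (cTgt p ∈ (E.bcBondConfig ω) ↔ cTgt p ∈ ((shiftData E w).bcBondConfig ω)) → infDist (meshPoint E.δ p.1) D.carrierᶜ < 3 * η :=
    fun p hp => lt_of_not_ge fun h => hp (hagree p h)
  have hinner : ∀ x : Site 2, 3 * η ≤ infDist (meshPoint E.δ x) D.carrierᶜ → ∀ f : Site 2, IsCorner x f → E.IsInnerFace f ∧ (shiftData E w).IsInnerFace f :=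
    fun x hx => (hcollar E hEΩ hE hδ₂' w hw ω x hx x (by rw [dist_self]; positivity)).2
  have hfaceE : ∀ t ≤ n, E.IsInnerFace (cFace (cornerOrbit (E.bcBondConfig ω) a t)) := by
    intro t ht
    rcases Nat.eq_zero_or_pos t with rfl | hpos
    · exact ha.isOutEdge.1
    · obtain ⟨t', rfl⟩ : ∃ t', t = t' + 1 := ⟨t - 1, by omega⟩
      exact (hStr t' (by omega)).2
  have hface₁ : ∀ t, 1 ≤ t → t ≤ T → (shiftData E w).IsInnerFace (cFace (cornerOrbit ((shiftData E w).bcBondConfig ω) a' t)) := by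
    intro t h1 ht
    obtain ⟨t', rfl⟩ : ∃ t', t = t' + 1 := ⟨t - 1, by omega⟩
    exact (hrun t' (by omega)).2
  have hsimple : ∀ s t, s < t → t ≤ n → cornerOrbit (E.bcBondConfig ω) a s ≠ cornerOrbit (E.bcBondConfig ω) a t :=
    fun s t hst htn => cornerOrbit_ne hE ha hst (fun k hk => hfaceE k (by omega))
  have hsimple₁ : ∀ s t, s < t → t ≤ T → cornerOrbit ((shiftData E w).bcBondConfig ω) a' s ≠ cornerOrbit ((shiftData E w).bcBondConfig ω) a' t := by
    intro s t hst htT h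
    have := cornerOrbit_injOn_run (I := {e | medialPoint E.δ e ∈ ball (meshPoint E.δ v) ρ}) hrun (Or.inl hTball) (by omega) htT h
    omega
  have hzD : ∀ t ≤ n, meshPoint E.δ (cornerOrbit (E.bcBondConfig ω) a t).1 ∈ D.carrier := by
    intro t ht
    rw [← hEΩ]
    exact (ufrs_discrepancyEdges E w ω).2.2 _ (hfaceE t ht)
  have hcola : infDist (meshPoint E.δ a.1) D.carrierᶜ < 3 * η := by
    by_contra h
    rw [not_lt] at h
    exact ha.isOutEdge.2 (hinner a.1 h (faceAt a.1 (a.2 + 3)) (isCorner_faceAt _ _)).1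
  -- escape regime
  by_cases hesc : ρ / 2 < 256 * (4 * η)
  · exact ⟨_, hzD 0 (Nat.zero_le _), hcola, mem_ufrsCert_of_lt_W3H hesc⟩
  rw [not_lt] at hesc
  -- the last contact `O₁ a' kS = O₀ a mS`
  obtain ⟨k₀, hk₀T, hk₀⟩ := hcontact
  obtain ⟨kS, hkST, ⟨mS, hmSn, hEq⟩, hmax⟩ : ∃ kS, kS ≤ T ∧ (∃ m ≤ n, cornerOrbit ((shiftData E w).bcBondConfig ω) a' kS = cornerOrbit (E.bcBondConfig ω) a m) ∧
      ∀ k, kS < k → k ≤ T → ∀ m ≤ n, cornerOrbit ((shiftData E w).bcBondConfig ω) a' k ≠ cornerOrbit (E.bcBondConfig ω) a m := by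
    refine ⟨Nat.findGreatest (fun k => ∃ m ≤ n, cornerOrbit ((shiftData E w).bcBondConfig ω) a' k = cornerOrbit (E.bcBondConfig ω) a m) T, Nat.findGreatest_le T,
      Nat.findGreatest_spec (P := fun k => ∃ m ≤ n, cornerOrbit ((shiftData E w).bcBondConfig ω) a' k = cornerOrbit (E.bcBondConfig ω) a m) hk₀T hk₀, fun k hk hkT m hm h => ?_⟩
    exact Nat.findGreatest_is_greatest (P := fun k => ∃ m ≤ n, cornerOrbit ((shiftData E w).bcBondConfig ω) a' k = cornerOrbit (E.bcBondConfig ω) a m) hk hkT ⟨m, hm, h⟩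
  have hkS : kS < T := by
    rcases lt_or_eq_of_le hkST with h | h
    · exact h
    · exfalso
      rw [h] at hEq
      rcases lt_or_eq_of_le hmSn with h' | h'
      · exact (hStr mS h').1 (by rw [← hEq]; exact hTball)
      · exact hlast (by rw [hEq, h'])
  have hmS : mS < n := by
    rcases lt_or_eq_of_le hmSn with h | h
    · exact h
    · exfalso
      refine (hrun kS hkS).1 ?_
      rw [hEq, h]
      exact hball
  -- lastness: the successors differ, so `cTgt (O₀ a mS)` is a discrepancy edge at a collar corner
  have hne : cornerOrbit ((shiftData E w).bcBondConfig ω) a' (kS + 1) ≠ cornerOrbit (E.bcBondConfig ω) a (mS + 1) :=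
    hmax (kS + 1) (Nat.lt_succ_self _) hkS (mS + 1) hmS
  have hdisc : ¬ (cTgt (cornerOrbit (E.bcBondConfig ω) a mS) ∈ (E.bcBondConfig ω) ↔ cTgt (cornerOrbit (E.bcBondConfig ω) a mS) ∈ ((shiftData E w).bcBondConfig ω)) := by
    intro hiff
    apply hne
    show nextCorner ((shiftData E w).bcBondConfig ω) (cornerOrbit ((shiftData E w).bcBondConfig ω) a' kS) = nextCorner (E.bcBondConfig ω) (cornerOrbit (E.bcBondConfig ω) a mS)
    rw [hEq, nextCorner_congr_of_iff hiff]
  have hcolS : infDist (meshPoint E.δ (cornerOrbit (E.bcBondConfig ω) a mS).1) D.carrierᶜ < 3 * η := hcol_of_disc _ hdisc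
  -- far ends: next to the ball
  have hfar : ∀ (c y : Site 2) (p : Site 2 × Fin 4), infDist (meshPoint E.δ c) D.carrierᶜ < 3 * η →
      medialPoint E.δ (cTgt p) ∈ ball (meshPoint E.δ v) ρ → dist (meshPoint E.δ y) (meshPoint E.δ p.1) ≤ E.δ →
      ρ / 2 / 2 ≤ dist (meshPoint E.δ y) (meshPoint E.δ c) := by
    intro c y p hc hp hy
    have := far_of_near_cTgt_mem_ball_W3H hδ.le hv hc (z := meshPoint E.δ c) (s := 0) (by rw [dist_self]) hp hy
    linarith
  have hx₀self : dist (meshPoint E.δ (cornerOrbit (E.bcBondConfig ω) a n).1) (meshPoint E.δ (cornerOrbit (E.bcBondConfig ω) a n).1) ≤ E.δ := by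
    rw [dist_self]; exact hδ.le
  have hTself : dist (meshPoint E.δ (cornerOrbit ((shiftData E w).bcBondConfig ω) a' T).1) (meshPoint E.δ (cornerOrbit ((shiftData E w).bcBondConfig ω) a' T).1) ≤ E.δ := by
    rw [dist_self]; exact hδ.le
  -- the certificate at `z = E.δ (O₀ a mS).1`
  refine ⟨meshPoint E.δ (cornerOrbit (E.bcBondConfig ω) a mS).1, hzD mS hmSn, hcolS, ?_⟩
  have hδ4 : E.δ ≤ 4 * η := by linarith
  have hS1near : dist (meshPoint E.δ (cornerOrbit (E.bcBondConfig ω) a (mS + 1)).1) (meshPoint E.δ (cornerOrbit (E.bcBondConfig ω) a mS).1) ≤ 4 * η := by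
    have h := dist_meshPoint_cornerOrbit_succ_le (E.bcBondConfig ω) a E.δ mS
    rw [abs_of_pos hδ] at h
    linarith
  have hS1 : ∀ R' : ℝ, R' ≤ ρ / 2 / 2 → (mS + 1) ≤ n ∧ ((dist (meshPoint E.δ (cornerOrbit (E.bcBondConfig ω) a (mS + 1)).1) (meshPoint E.δ (cornerOrbit (E.bcBondConfig ω) a mS).1) ≤ (4 * η) ∧ R' ≤ dist (meshPoint E.δ (cornerOrbit (E.bcBondConfig ω) a n).1) (meshPoint E.δ (cornerOrbit (E.bcBondConfig ω) a mS).1)) ∨ (R' ≤ dist (meshPoint E.δ (cornerOrbit (E.bcBondConfig ω) a (mS + 1)).1) (meshPoint E.δ (cornerOrbit (E.bcBondConfig ω) a mS).1) ∧ dist (meshPoint E.δ (cornerOrbit (E.bcBondConfig ω) a n).1) (meshPoint E.δ (cornerOrbit (E.bcBondConfig ω) a mS).1) ≤ (4 * η))) ∧ (∀ t, (mS + 1) ≤ t → t ≤ n → E.IsInnerFace (cFace (cornerOrbit (E.bcBondConfig ω) a t))) ∧ (∀ s t, (mS + 1) ≤ s → s < t → t ≤ n → cornerOrbit (E.bcBondConfig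 ω) a s ≠ cornerOrbit (E.bcBondConfig ω) a t) :=
    fun R' hR' => ⟨hmS, Or.inl ⟨hS1near, hR'.trans (hfar _ _ _ hcolS hball hx₀self)⟩, fun t _ ht => hfaceE t ht, fun s t _ hst htn => hsimple s t hst htn⟩
  have hS2near : dist (meshPoint E.δ (cornerOrbit ((shiftData E w).bcBondConfig ω) a' (kS + 1)).1) (meshPoint E.δ (cornerOrbit (E.bcBondConfig ω) a mS).1) ≤ 4 * η := by
    have h := dist_meshPoint_cornerOrbit_succ_le ((shiftData E w).bcBondConfig ω) a' E.δ kS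
    rw [abs_of_pos hδ, hEq] at h
    linarith
  have hS2 : ∀ R' : ℝ, R' ≤ ρ / 2 / 2 → (kS + 1) ≤ T ∧ ((dist (meshPoint E.δ (cornerOrbit ((shiftData E w).bcBondConfig ω) a' (kS + 1)).1) (meshPoint E.δ (cornerOrbit (E.bcBondConfig ω) a mS).1) ≤ (4 * η) ∧ R' ≤ dist (meshPoint E.δ (cornerOrbit ((shiftData E w).bcBondConfig ω) a' T).1) (meshPoint E.δ (cornerOrbit (E.bcBondConfig ω) a mS).1)) ∨ (R' ≤ dist (meshPoint E.δ (cornerOrbit ((shiftData E w).bcBondConfig ω) a' (kS + 1)).1) (meshPoint E.δ (cornerOrbit (E.bcBondConfig ω) a mS).1) ∧ dist (meshPoint E.δ (cornerOrbit ((shiftData E w).bcBondConfig ω) a' T).1) (meshPoint E.δ (cornerOrbit (E.bcBondConfig ω) a mS).1) ≤ (4 * η))) ∧ (∀ t, (kS + 1) ≤ t → t ≤ T → (shiftData E w).IsInnerFace (cFace (cornerOrbit ((shiftData E w).bcBondConfig ω) a' t))) ∧ (∀ s t, (kS + 1) ≤ s → s < t → t ≤ T → cornerOrbit ((shiftData E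 w).bcBondConfig ω) a' s ≠ cornerOrbit ((shiftData E w).bcBondConfig ω) a' t) :=
    fun R' hR' => ⟨hkS, Or.inl ⟨hS2near, hR'.trans (hfar _ _ _ hcolS hTball hTself)⟩, fun t ht1 htT => hface₁ t (by omega) htT, fun s t _ hst htT => hsimple₁ s t hst htT⟩
  have hS12 : ∀ s t, (mS + 1) ≤ s → s ≤ n → (kS + 1) ≤ t → t ≤ T → cornerOrbit (E.bcBondConfig ω) a s ≠ cornerOrbit ((shiftData E w).bcBondConfig ω) a' t :=
    fun s t _ hsn ht1 htT h => hmax t (by omega) htT s hsn h.symm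
  have hmk : ∀ X : ℝ, dist (meshPoint E.δ a.1) (meshPoint E.δ (cornerOrbit (E.bcBondConfig ω) a mS).1) ≤ X → ∃ e₀ : Sym2 (Site 2), (e₀ ∈ E.zdABEdges ∨ e₀ ∈ (shiftData E w).zdABEdges) ∧
      dist (medialPoint E.δ e₀) (meshPoint E.δ (cornerOrbit (E.bcBondConfig ω) a mS).1) ≤ X + E.δ := by
    intro X hX
    refine ⟨cSrc a, Or.inl (DiscreteDobrushin.cSrc_mem_zdABEdges ha.mem_zdArcA ha.mem_zdArcB (Or.inl ha.isOutEdge)), ?_⟩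
    have h1 := dist_medialPoint_cSrc_le' hδ.le a
    have h2 := dist_triangle (medialPoint E.δ (cSrc a)) (meshPoint E.δ a.1) (meshPoint E.δ (cornerOrbit (E.bcBondConfig ω) a mS).1)
    linarith
  rcases Nat.eq_zero_or_pos mS with hr0 | hrpos
  · -- the last contact is at the start corner: the marked edge `cSrc a` is at `z`
    subst hr0
    have hX0 : dist (meshPoint E.δ a.1) (meshPoint E.δ (cornerOrbit (E.bcBondConfig ω) a 0).1) ≤ 0 := by
      show dist (meshPoint E.δ a.1) (meshPoint E.δ a.1) ≤ 0
      rw [dist_self]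
    have hXlt : (0:ℝ) < ρ / 2 / 2 := by linarith
    exact mem_ufrsCert_of_two_far_and_marked_W3H true false true a a' a (0 + 1) n (kS + 1) T 0 0 hη hδη hXlt (hmk 0 hX0) hS1 hS2 hS12
      (fun hbig => False.elim (by linarith))
  · -- the prefix `O₀ a [0, mS - 1]`, read back to the start corner
    have hS3near : dist (meshPoint E.δ (cornerOrbit (E.bcBondConfig ω) a (mS - 1)).1) (meshPoint E.δ (cornerOrbit (E.bcBondConfig ω) a mS).1) ≤ 4 * η := by
      have h := dist_meshPoint_cornerOrbit_succ_le (E.bcBondConfig ω) a E.δ (mS - 1)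
      rw [abs_of_pos hδ, Nat.sub_add_cancel hrpos, dist_comm] at h
      linarith
    have hS3 : ∀ R' : ℝ, R' ≤ dist (meshPoint E.δ a.1) (meshPoint E.δ (cornerOrbit (E.bcBondConfig ω) a mS).1) → 0 ≤ (mS - 1) ∧ ((dist (meshPoint E.δ (cornerOrbit (E.bcBondConfig ω) a 0).1) (meshPoint E.δ (cornerOrbit (E.bcBondConfig ω) a mS).1) ≤ (4 * η) ∧ R' ≤ dist (meshPoint E.δ (cornerOrbit (E.bcBondConfig ω) a (mS - 1)).1) (meshPoint E.δ (cornerOrbit (E.bcBondConfig ω) a mS).1)) ∨ (R' ≤ dist (meshPoint E.δ (cornerOrbit (E.bcBondConfig ω) a 0).1) (meshPoint E.δ (cornerOrbit (E.bcBondConfig ω) a mS).1) ∧ dist (meshPoint E.δ (cornerOrbit (E.bcBondConfig ω) a (mS - 1)).1) (meshPoint E.δ (cornerOrbit (E.bcBondConfig ω) a mS).1) ≤ (4 * η))) ∧ (∀ t, 0 ≤ t → t ≤ (mS - 1) → E.IsInnerFace (cFace (cornerOrbit (E.bcBondConfig ω) a t))) ∧ (∀ s t, 0 ≤ s → s < t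 → t ≤ (mS - 1) → cornerOrbit (E.bcBondConfig ω) a s ≠ cornerOrbit (E.bcBondConfig ω) a t) :=
      fun R' hR' => ⟨Nat.zero_le _, Or.inr ⟨hR', hS3near⟩, fun t _ ht => hfaceE t (by omega), fun s t _ hst ht => hsimple s t hst (by omega)⟩
    have hS13 : ∀ s t, (mS + 1) ≤ s → s ≤ n → 0 ≤ t → t ≤ (mS - 1) → cornerOrbit (E.bcBondConfig ω) a s ≠ cornerOrbit (E.bcBondConfig ω) a t :=
      fun s t hs hsn _ ht h => hsimple t s (by omega) hsn h.symm
    have hS23 : ∀ s t, (kS + 1) ≤ s → s ≤ T → 0 ≤ t → t ≤ (mS - 1) → cornerOrbit ((shiftData E w).bcBondConfig ω) a' s ≠ cornerOrbit (E.bcBondConfig ω) a t :=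
      fun s t hs hsT _ ht h => hmax s (by omega) hsT t (by omega) h
    by_cases hXfar : ρ / 2 / 2 ≤ dist (meshPoint E.δ a.1) (meshPoint E.δ (cornerOrbit (E.bcBondConfig ω) a mS).1)
    · exact mem_ufrsCert_of_three_far_W3H true false true a a' a (mS + 1) n (kS + 1) T 0 (mS - 1) hη hesc (hS1 _ le_rfl) (hS2 _ le_rfl)
        (hS3 _ hXfar) hS12 hS13 hS23
    · rw [not_le] at hXfar
      exact mem_ufrsCert_of_two_far_and_marked_W3H true false true a a' a (mS + 1) n (kS + 1) T 0 (mS - 1) hη hδη hXfar (hmk _ le_rfl)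
        hS1 hS2 hS12 (fun _ => ⟨hS3 _ le_rfl, hS13, hS23⟩)

end

end Summit.CriticalPhenomena.CardyFormulaZ2.Cruxes.EdgePrecompact.QkzStripBoundaryArm
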